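import Literature.MathematicalPhysics.QuantumFieldTheory.BlockScaleEffectivePerturbation
import HarnessLib

/-!
# Bałaban's format as rendered in the tree is blind to POSITIVE parts of the localized terms

Topic `Literature/MathematicalPhysics/QuantumFieldTheory` (kind proof; companion of
`BlockScaleEffectivePerturbation.lean`, same namespace; no new notions).

`BalabanEffectiveAction.InFormat ρ D κ B₀ C₀ := terms.HasAnalyticNormLE ρ D κ B₀ ∧
terms.HasLargeFieldFloor κ C₀` collapses Bałaban's format (CMP 119 (1988) §2, (2.25)–(2.28),
(2.40)–(2.42), (2.49)) to (i) analyticity with weighted sup-norm `≤ B₀` of the holomorphic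
extensions on the domains `D X` — a predicate that only sees the REAL configurations lying INSIDE
`D X` (`IsAnalyticOn`: the extension agrees with `W_X` there and nowhere else) — and (ii) a floor on
the NEGATIVE parts (`HasLargeFieldFloor`: the terms may not lower the action by more than `C₀` per
block).  Consequently it says nothing about how strongly a term may RAISE the action (suppress
configurations) off the domains:

* `inFormat_of_nonneg_of_eq_zero_on` — **positive-part blindness**: if every activity of `W` is
  `≥ 0` and vanishes at the real points of its domain `D X`, then `⟨β, W⟩` is in format with the best
  constants `(κ, 0, 0)` for EVERY `κ` and `β` (extensions `F_X := 0`, bounds `M := 0`; floor `0` by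
  `hasLargeFieldFloor_of_nonneg`), hence (`inFormat_of_nonneg_of_eq_zero_on'`) with any `B₀, C₀ ≥ 0`.

So an arbitrarily large non-negative activity on a large polymer supported on large-field
configurations (off `D X`) is "in format"; at fixed coupling such configurations are typical in large
volume (extensive entropy of large fields), and the weights `e^{κ|X|}` of the norms never see positive
parts.  Consumers that need control of the Gibbs measure of `⟨β, W⟩` uniformly in the volume must
therefore add a two-sided real bound (`terms.NormLE κ B₀`, as the robust-Yang–Mills lines do) or carry
large-field suppression as a separate rough-region factor (`BalabanFormatDensity`).  Found by the
crux chain of `ParabolicTrajectory.TunedSequenceExists` (stmt-QuantumFields-10524, line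
`transport-to-fixed-distance`, 2026-08-16): it makes the registered stub `FormatRobustness` false.

## References

* T. Bałaban, *Convergent renormalization expansions for lattice gauge theories*, Commun. Math.
  Phys. 119 (1988) 243–285, §2 (the inductive format: (2.25)–(2.28), (2.40)–(2.42), (2.49)).
-/

noncomputable section

namespace Literature.MathematicalPhysics.QuantumFieldTheory

variable {d N : ℕ} {G : Type*} [Group G] [MeasurableSpace G] {S c : ℕ} [NeZero S]
  (ρ : G →* Matrix (Fin N) (Fin N) ℂ)

/-- **Positive-part blindness of the collapsed format.**  If every polymer activity of `W` is
non-negative and vanishes at the real configurations lying in its analyticity domain `D X`, then the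
effective action `⟨β, W⟩` is `InFormat ρ D κ 0 0` for every `κ` and `β`: the zero functions are
holomorphic extensions with bounds `0`, and non-negative terms have large-field floor `0`.  In
particular the format puts no constraint on positive activities supported off the domains
(Bałaban 1988, §2: his format bounds `|E(X)|` two-sidedly on the analyticity spaces and controls
large fields through the separate factors `χ_k`, `T_k` of (2.18) — both lost in the collapse).
[cite: Balaban1988Convergent, p. 259 (2.25)–(2.28) and p. 264 (2.49)] -/
theorem inFormat_of_nonneg_of_eq_zero_on (W : BlockScaleEffectivePerturbation d S G c)
    (D : Finset (Site d S) → Set (ComplexGaugeConfig d S N))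
    (hnonneg : ∀ X ∈ polymers (d := d) (L := S) c, ∀ U, 0 ≤ W.act X U)
    (hzero : ∀ X ∈ polymers (d := d) (L := S) c, ∀ U : GaugeConfig d S G,
      complexify ρ U ∈ D X → W.act X U = 0)
    (β κ : ℝ) :
    (⟨β, W⟩ : BalabanEffectiveAction d S G c).InFormat ρ D κ 0 0 := by
  refine ⟨⟨fun _ => 0, fun X hX => ⟨0, differentiableOn_const 0, fun U hU => ?_, fun Z _ => by simp⟩,
    fun y _ => by simp⟩, ?_⟩
  · simp [hzero X hX U hU]
  · exact QuasiLocalGaugePerturbation.hasLargeFieldFloor_of_nonneg hnonneg le_rfl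

/-- Positive-part blindness with arbitrary non-negative constants `(B₀, C₀)` (monotonicity of both
format predicates). [cite: Balaban1988Convergent, p. 259 (2.25)–(2.28) and p. 264 (2.49)] -/
theorem inFormat_of_nonneg_of_eq_zero_on' (W : BlockScaleEffectivePerturbation d S G c)
    (D : Finset (Site d S) → Set (ComplexGaugeConfig d S N))
    (hnonneg : ∀ X ∈ polymers (d := d) (L := S) c, ∀ U, 0 ≤ W.act X U)
    (hzero : ∀ X ∈ polymers (d := d) (L := S) c, ∀ U : GaugeConfig d S G,
      complexify ρ U ∈ D X → W.act X U = 0)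
    (β κ : ℝ) {B₀ C₀ : ℝ} (hB₀ : 0 ≤ B₀) (hC₀ : 0 ≤ C₀) :
    (⟨β, W⟩ : BalabanEffectiveAction d S G c).InFormat ρ D κ B₀ C₀ :=
  ⟨(inFormat_of_nonneg_of_eq_zero_on ρ W D hnonneg hzero β κ).1.mono ρ hB₀,
    (inFormat_of_nonneg_of_eq_zero_on ρ W D hnonneg hzero β κ).2.mono hC₀⟩

end Literature.MathematicalPhysics.QuantumFieldTheory

end
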